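import Summits.AtomisticToContinuum.FouriersLaw.Theorems.JunctionLocalityNonBallisticStubLightConeWindow

/-!
# Leaf (C) `stub_anchoredCorrelationTails`, part 6: the pairing bound
(crux `EmbeddedDrudeMourre.AbelThermodynamicLimit`, item stmt-AtomisticToContinuum-12596, line
`loomis-compact-horizon-witness`; `--supports` file proving the registered sub-goal `stub_conePairing`)

`abs_pairCorr_le_of_singleFlips` — for genuine bonds `c`, `k` of the open `N`-chain at equilibrium,
`|∫ j_c · κ_s j_k dμ_T| ≤ √(M/2)(B₁ + B₂)` whenever `∫ j_c² dμ_T ≤ M` and the pathwise mean squares of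
`j_k(Φ_s(Θ_i x, ω)) − j_k(Φ_s(x, ω))` (two strong solutions driven by the SAME Brownian pair, `Θ_i` the flip of the
momentum at `i`) are `≤ B₁²` for `i = c` and `≤ B₂²` for `i = c + 1`: `j_c` is odd under the flip `Θ_cΘ_{c+1}` of its
two momenta (`bondCurrent_contactFlip_succ`), which preserves `μ_T`, so `4(∫ j_c h)² ≤ ∫ j_c² · ∫ (h − h∘Θ_cΘ_{c+1})²`
(`four_mul_sq_integral_le`, the odd-pairing calculus of the landed `NonBallistic` light-cone window, now at an arbitrary
anchor); the flip difference splits into the two single flips (flip invariance, `FSAssembly.lintegral_comp_momentumFlip_gibbs`),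
each bounded by its pathwise mean square (Jensen, `FSAssembly.sq_kernel_sub_le_integral_sq`). Folklore; no definitions.
-/

noncomputable section

namespace Summit.AtomisticToContinuum.FouriersLaw.Theorems.AbelThermodynamicLimit.LoomisCompactHorizonWitness

open MeasureTheory ProbabilityTheory Set Filter Topology
open scoped NNReal ENNReal
open Literature.MathematicalPhysics.KineticTheory Literature.MathematicalPhysics.KineticTheory.HeatConduction
open Literature.Probability.Process OscillatorChain
open Summit.AtomisticToContinuum.FouriersLaw.Theorems.NonBallistic
open Summit.AtomisticToContinuum.FouriersLaw.Theorems.SubdiffusiveBondHeat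
open Summit.AtomisticToContinuum.FouriersLaw.Theorems.LightConeBondHeat (pinnedChain_abs_bondCurrent_le_exp
  quarter_inv_temp_admissible)
open Summit.AtomisticToContinuum.FouriersLaw.Theorems.OddResponseBound.Negative.OddPairing (four_mul_sq_integral_le)

/-! ### §5 The pairing: pair correlations from the two single flips -/

section Pairing

/-- The bond current `j_c = -½(p_c + p_{c+1})V'(q_{c+1} - q_c)` is odd under the flip of its two momenta. [folklore] -/
theorem bondCurrent_contactFlip_succ (P : OscillatorChain) {N : ℕ} (c c1 : Fin N) (hc1 : c1.val = c.val + 1)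
    (x : PhaseSpace N) :
    P.bondCurrent N c (momentumFlip c (momentumFlip c1 x)) = -P.bondCurrent N c x := by
  -- adapted from `bondCurrent_zero_contactFlip` (…NonBallisticStubLightConeWindowAux1)
  have hne : c ≠ c1 := fun h => by rw [← h] at hc1; omega
  have hne' : c1 ≠ c := fun h => hne h.symm
  simp only [OscillatorChain.bondCurrent, momentumFlip_fst, ← Finset.sum_neg_distrib]
  refine Finset.sum_congr rfl fun j _ => ?_
  by_cases h : (j : ℕ) = (c : ℕ) + 1
  · have hj : j = c1 := Fin.ext (by omega)
    subst hj
    rw [if_pos h, if_pos h, momentumFlip_snd_self, momentumFlip_snd_of_ne hne, momentumFlip_snd_of_ne hne',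
      momentumFlip_snd_self]
    ring
  · rw [if_neg h, if_neg h, neg_zero]

variable {ω₂ lam β γ : ℝ} (hω : 0 < ω₂) (hl : 0 < lam) (hβ : 0 < β) (hγ : 0 < γ) {N : ℕ} {T : ℝ} (hT : 0 < T)

include hω hl hβ hγ hT in
/-- **The pairing bound.** For genuine bonds `c` and `k`, `M ≥ ∫ j_c² dμ_T`, and single-flip mean squares at the two
momenta of `j_c` bounded by `B₁²` (flip at `c`) and `B₂²` (flip at `c+1`), the equilibrium pair correlation obeys
`|∫ j_c · κ_s j_k dμ_T| ≤ √(M/2) (B₁ + B₂)`: `j_c` is odd under the flip `Θ = Θ_cΘ_{c+1}` of its two momenta, which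
preserves `μ_T`, so `4(∫ j_c h)² ≤ ∫ j_c² · ∫ (h − h∘Θ)²` (`four_mul_sq_integral_le`), and
`∫ (h − h∘Θ)² ≤ 2∫(h − h∘Θ_{c+1})² + 2∫(h − h∘Θ_c)²` (flip invariance), each `≤` its pathwise mean square (Jensen,
`FSAssembly.sq_kernel_sub_le_integral_sq`). [folklore] -/
theorem abs_pairCorr_le_of_singleFlips (hN : 0 < N) (c k : Fin N) (hc : c.val + 1 < N) {M : ℝ}
    (hM : ∫ x, (pinnedChain ω₂ lam β γ).bondCurrent N c x ^ 2 ∂((pinnedChain ω₂ lam β γ).gibbsMeasure N T) ≤ M)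
    (s : ℝ≥0) {B₁ B₂ : ℝ} (hB₁ : 0 ≤ B₁) (hB₂ : 0 ≤ B₂)
    (h₁ : ∫⁻ x, ∫⁻ ω, ENNReal.ofReal
        (((pinnedChain ω₂ lam β γ).bondCurrent N k
            ((pinnedChain ω₂ lam β γ).solMap N T T s (momentumFlip c x) (pairPath ω)) -
          (pinnedChain ω₂ lam β γ).bondCurrent N k
            ((pinnedChain ω₂ lam β γ).solMap N T T s x (pairPath ω))) ^ 2)
        ∂wienerPair ∂((pinnedChain ω₂ lam β γ).gibbsMeasure N T) ≤ ENNReal.ofReal (B₁ ^ 2))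
    (h₂ : ∫⁻ x, ∫⁻ ω, ENNReal.ofReal
        (((pinnedChain ω₂ lam β γ).bondCurrent N k
            ((pinnedChain ω₂ lam β γ).solMap N T T s (momentumFlip ⟨c.val + 1, hc⟩ x) (pairPath ω)) -
          (pinnedChain ω₂ lam β γ).bondCurrent N k
            ((pinnedChain ω₂ lam β γ).solMap N T T s x (pairPath ω))) ^ 2)
        ∂wienerPair ∂((pinnedChain ω₂ lam β γ).gibbsMeasure N T) ≤ ENNReal.ofReal (B₂ ^ 2)) :
    |∫ x, (pinnedChain ω₂ lam β γ).bondCurrent N c x *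
        (∫ y, (pinnedChain ω₂ lam β γ).bondCurrent N k y ∂((pinnedChain ω₂ lam β γ).transitionKernel N T T s x))
        ∂((pinnedChain ω₂ lam β γ).gibbsMeasure N T)| ≤ Real.sqrt (M / 2) * (B₁ + B₂) := by
  set P := pinnedChain ω₂ lam β γ with hP
  set μ := P.gibbsMeasure N T with hμ
  haveI hμP : IsProbabilityMeasure μ := pinnedChain_isProbabilityMeasure_gibbsMeasure hω hl.le hβ.le γ N hT
  set c1 : Fin N := ⟨c.val + 1, hc⟩ with hc1
  set κ := P.transitionKernel N T T s with hκ
  set h : PhaseSpace N → ℝ := fun x => ∫ y, P.bondCurrent N k y ∂(κ x) with hh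
  -- `L²(μ_T)` facts
  obtain ⟨hϑ0, h2ϑ⟩ := quarter_inv_temp_admissible hT
  have hji := pinnedChain_integral_sq_act_le hω hl.le hβ hγ hN hT hϑ0 h2ϑ
    (pinnedChain_continuous_bondCurrent ω₂ lam β γ N c) (pinnedChain_abs_bondCurrent_le_exp hω.le hl.le hβ.le γ N hϑ0 c) s
  have hjk := pinnedChain_integral_sq_act_le hω hl.le hβ hγ hN hT hϑ0 h2ϑ
    (pinnedChain_continuous_bondCurrent ω₂ lam β γ N k) (pinnedChain_abs_bondCurrent_le_exp hω.le hl.le hβ.le γ N hϑ0 k) s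
  have hj2 : MemLp (P.bondCurrent N c) 2 μ :=
    (memLp_two_iff_integrable_sq (pinnedChain_continuous_bondCurrent ω₂ lam β γ N c).aestronglyMeasurable).2 hji.1
  have hhm : StronglyMeasurable h :=
    (pinnedChain_continuous_bondCurrent ω₂ lam β γ N k).stronglyMeasurable.integral_kernel (κ := κ)
  have hh2 : MemLp h 2 μ := (memLp_two_iff_integrable_sq hhm.aestronglyMeasurable).2 hjk.2.1
  have hM0 : 0 ≤ M := le_trans (integral_nonneg fun x => sq_nonneg _) hM
  -- the flip of the two momenta of `j_c`
  set Θ : PhaseSpace N → PhaseSpace N := fun x => momentumFlip c (momentumFlip c1 x) with hΘ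
  have hΘmp : MeasurePreserving Θ μ μ := measurePreserving_contactFlip_gibbsMeasure P N T c c1
  have hΘm : Measurable Θ := measurable_contactFlip c c1
  have hΘinv : Function.Involutive Θ := contactFlip_involutive c c1
  have hodd : ∀ x, P.bondCurrent N c (Θ x) = -P.bondCurrent N c x := bondCurrent_contactFlip_succ P c c1 rfl
  have hpair := four_mul_sq_integral_le hΘmp hΘm hΘinv hodd hj2 hh2
  -- the flip-difference of `h` in `L²`, through the two single flips
  have hhmeas : Measurable h := hhm.measurable
  have hsingle : ∀ (i : Fin N) {B : ℝ}, 0 ≤ B →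
      (∫⁻ x, ∫⁻ ω, ENNReal.ofReal ((P.bondCurrent N k (P.solMap N T T s (momentumFlip i x) (pairPath ω)) -
          P.bondCurrent N k (P.solMap N T T s x (pairPath ω))) ^ 2) ∂wienerPair ∂μ ≤ ENNReal.ofReal (B ^ 2)) →
      ∫⁻ x, ENNReal.ofReal ((h x - h (momentumFlip i x)) ^ 2) ∂μ ≤ ENNReal.ofReal (B ^ 2) := by
    intro i B hB hfl
    refine le_trans (lintegral_mono fun x => ?_) hfl
    have hJ := FSAssembly.sq_kernel_sub_le_integral_sq hω hl.le hβ hγ hN hT k s (momentumFlip i x) x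
    have e : (h x - h (momentumFlip i x)) ^ 2 = (h (momentumFlip i x) - h x) ^ 2 := by ring
    rw [e]
    exact (ENNReal.ofReal_le_ofReal hJ).trans
      (ProfileAntitone.ofReal_integral_le_lintegral_ofReal' (ae_of_all _ fun _ => sq_nonneg _))
  have hX1 := hsingle c hB₁ h₁
  have hX2 := hsingle c1 hB₂ h₂
  have hXl : ∫⁻ x, ENNReal.ofReal ((h x - h (Θ x)) ^ 2) ∂μ ≤ ENNReal.ofReal (2 * B₂ ^ 2 + 2 * B₁ ^ 2) := by
    have hpt : ∀ x, ENNReal.ofReal ((h x - h (Θ x)) ^ 2) ≤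
        2 * ENNReal.ofReal ((h x - h (momentumFlip c1 x)) ^ 2) +
          2 * ENNReal.ofReal ((h (momentumFlip c1 x) - h (momentumFlip c (momentumFlip c1 x))) ^ 2) := by
      intro x
      have e : (h x - h (Θ x)) ^ 2 ≤ 2 * (h x - h (momentumFlip c1 x)) ^ 2 +
          2 * (h (momentumFlip c1 x) - h (momentumFlip c (momentumFlip c1 x))) ^ 2 := by
        simp only [hΘ]
        nlinarith [sq_nonneg ((h x - h (momentumFlip c1 x)) - (h (momentumFlip c1 x) - h (momentumFlip c (momentumFlip c1 x))))]
      calc ENNReal.ofReal ((h x - h (Θ x)) ^ 2) ≤ ENNReal.ofReal (2 * (h x - h (momentumFlip c1 x)) ^ 2 +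
            2 * (h (momentumFlip c1 x) - h (momentumFlip c (momentumFlip c1 x))) ^ 2) := ENNReal.ofReal_le_ofReal e
        _ = _ := by
            rw [ENNReal.ofReal_add (by positivity) (by positivity), ENNReal.ofReal_mul (by norm_num),
              ENNReal.ofReal_mul (by norm_num), ENNReal.ofReal_ofNat]
    have hm1 : Measurable fun x => ENNReal.ofReal ((h x - h (momentumFlip c1 x)) ^ 2) :=
      ((hhmeas.sub (hhmeas.comp (measurable_momentumFlip c1))).pow_const 2).ennreal_ofReal
    have hFm : Measurable fun y => ENNReal.ofReal ((h y - h (momentumFlip c y)) ^ 2) :=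
      ((hhmeas.sub (hhmeas.comp (measurable_momentumFlip c))).pow_const 2).ennreal_ofReal
    have hm2 : Measurable fun x =>
        ENNReal.ofReal ((h (momentumFlip c1 x) - h (momentumFlip c (momentumFlip c1 x))) ^ 2) := by
      have h' := (((hhmeas.comp (measurable_momentumFlip c1)).sub
        (hhmeas.comp ((measurable_momentumFlip c).comp (measurable_momentumFlip c1)))).pow_const 2).ennreal_ofReal
      exact h'
    have hflip : ∫⁻ x, ENNReal.ofReal ((h (momentumFlip c1 x) - h (momentumFlip c (momentumFlip c1 x))) ^ 2) ∂μ =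
        ∫⁻ y, ENNReal.ofReal ((h y - h (momentumFlip c y)) ^ 2) ∂μ :=
      FSAssembly.lintegral_comp_momentumFlip_gibbs P N T c1 hFm
    calc ∫⁻ x, ENNReal.ofReal ((h x - h (Θ x)) ^ 2) ∂μ
        ≤ ∫⁻ x, (2 * ENNReal.ofReal ((h x - h (momentumFlip c1 x)) ^ 2) +
            2 * ENNReal.ofReal ((h (momentumFlip c1 x) - h (momentumFlip c (momentumFlip c1 x))) ^ 2)) ∂μ :=
          lintegral_mono hpt
      _ = 2 * ∫⁻ x, ENNReal.ofReal ((h x - h (momentumFlip c1 x)) ^ 2) ∂μ +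
            2 * ∫⁻ y, ENNReal.ofReal ((h y - h (momentumFlip c y)) ^ 2) ∂μ := by
          rw [lintegral_add_left (hm1.const_mul 2), lintegral_const_mul 2 hm1, lintegral_const_mul 2 hm2, hflip]
      _ ≤ 2 * ENNReal.ofReal (B₂ ^ 2) + 2 * ENNReal.ofReal (B₁ ^ 2) := add_le_add (mul_le_mul' le_rfl hX2) (mul_le_mul' le_rfl hX1)
      _ = ENNReal.ofReal (2 * B₂ ^ 2 + 2 * B₁ ^ 2) := by
          rw [ENNReal.ofReal_add (by positivity) (by positivity), ENNReal.ofReal_mul (by norm_num),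
            ENNReal.ofReal_mul (by norm_num), ENNReal.ofReal_ofNat]
  have hX : ∫ x, (h x - h (Θ x)) ^ 2 ∂μ ≤ 2 * B₂ ^ 2 + 2 * B₁ ^ 2 := by
    have hint : Integrable (fun x => (h x - h (Θ x)) ^ 2) μ := (hh2.sub (hh2.comp_measurePreserving hΘmp)).integrable_sq
    rw [integral_eq_lintegral_of_nonneg_ae (ae_of_all _ fun x => sq_nonneg _) hint.aestronglyMeasurable]
    exact ENNReal.toReal_le_of_le_ofReal (by positivity) hXl
  -- conclusion
  have hX0 : 0 ≤ ∫ x, (h x - h (Θ x)) ^ 2 ∂μ := integral_nonneg fun x => sq_nonneg _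
  have hK2 : (∫ x, P.bondCurrent N c x * h x ∂μ) ^ 2 ≤ (Real.sqrt (M / 2) * (B₁ + B₂)) ^ 2 := by
    rw [mul_pow, Real.sq_sqrt (by positivity)]
    have h1 : (∫ x, P.bondCurrent N c x ^ 2 ∂μ) * ∫ x, (h x - h (Θ x)) ^ 2 ∂μ ≤ M * (2 * B₂ ^ 2 + 2 * B₁ ^ 2) :=
      mul_le_mul hM hX hX0 hM0
    nlinarith [hpair, h1, mul_nonneg hM0 (mul_nonneg hB₁ hB₂)]
  exact (Real.abs_le_sqrt hK2).trans_eq (Real.sqrt_sq (by positivity))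

end Pairing


/-- **Registered sub-goal `stub_conePairing`** (leaf (C) of S4, line `loomis-compact-horizon-witness`): the pairing
bound — pair correlations of bond currents from the two single-flip mean squares (`abs_pairCorr_le_of_singleFlips`,
closed form). [folklore] -/
theorem stub_conePairing :
    ∀ ω₂ lam β γ : ℝ, 0 < ω₂ → 0 < lam → 0 < β → 0 < γ → ∀ (N : ℕ), 0 < N → ∀ T : ℝ, 0 < T →
      ∀ (c k : Fin N) (hc : c.val + 1 < N) (M : ℝ),
        ∫ x, (Literature.MathematicalPhysics.KineticTheory.HeatConduction.pinnedChain ω₂ lam β γ).bondCurrent N c x ^ 2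
            ∂((Literature.MathematicalPhysics.KineticTheory.HeatConduction.pinnedChain ω₂ lam β γ).gibbsMeasure N T) ≤ M →
        ∀ (s : NNReal) (B₁ B₂ : ℝ), 0 ≤ B₁ → 0 ≤ B₂ →
        ∫⁻ x, ∫⁻ ω, ENNReal.ofReal
            (((Literature.MathematicalPhysics.KineticTheory.HeatConduction.pinnedChain ω₂ lam β γ).bondCurrent N k
                ((Literature.MathematicalPhysics.KineticTheory.HeatConduction.pinnedChain ω₂ lam β γ).solMap N T T s
                  (Literature.MathematicalPhysics.KineticTheory.HeatConduction.momentumFlip c x) (Literature.Probability.Process.pairPath ω)) -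
              (Literature.MathematicalPhysics.KineticTheory.HeatConduction.pinnedChain ω₂ lam β γ).bondCurrent N k
                ((Literature.MathematicalPhysics.KineticTheory.HeatConduction.pinnedChain ω₂ lam β γ).solMap N T T s x
                  (Literature.Probability.Process.pairPath ω))) ^ 2)
            ∂Literature.Probability.Process.wienerPair
            ∂((Literature.MathematicalPhysics.KineticTheory.HeatConduction.pinnedChain ω₂ lam β γ).gibbsMeasure N T) ≤ ENNReal.ofReal (B₁ ^ 2) →
        ∫⁻ x, ∫⁻ ω, ENNReal.ofReal
            (((Literature.MathematicalPhysics.KineticTheory.HeatConduction.pinnedChain ω₂ lam β γ).bondCurrent N k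
                ((Literature.MathematicalPhysics.KineticTheory.HeatConduction.pinnedChain ω₂ lam β γ).solMap N T T s
                  (Literature.MathematicalPhysics.KineticTheory.HeatConduction.momentumFlip ⟨c.val + 1, hc⟩ x)
                  (Literature.Probability.Process.pairPath ω)) -
              (Literature.MathematicalPhysics.KineticTheory.HeatConduction.pinnedChain ω₂ lam β γ).bondCurrent N k
                ((Literature.MathematicalPhysics.KineticTheory.HeatConduction.pinnedChain ω₂ lam β γ).solMap N T T s x
                  (Literature.Probability.Process.pairPath ω))) ^ 2)
            ∂Literature.Probability.Process.wienerPair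
            ∂((Literature.MathematicalPhysics.KineticTheory.HeatConduction.pinnedChain ω₂ lam β γ).gibbsMeasure N T) ≤ ENNReal.ofReal (B₂ ^ 2) →
        |∫ x, (Literature.MathematicalPhysics.KineticTheory.HeatConduction.pinnedChain ω₂ lam β γ).bondCurrent N c x *
            (∫ y, (Literature.MathematicalPhysics.KineticTheory.HeatConduction.pinnedChain ω₂ lam β γ).bondCurrent N k y
              ∂((Literature.MathematicalPhysics.KineticTheory.HeatConduction.pinnedChain ω₂ lam β γ).transitionKernel N T T s x))
            ∂((Literature.MathematicalPhysics.KineticTheory.HeatConduction.pinnedChain ω₂ lam β γ).gibbsMeasure N T)| ≤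
          Real.sqrt (M / 2) * (B₁ + B₂) :=
  fun _ _ _ _ hω hl hβ hγ _ hN _ hT c k hc _ hM s _ _ hB₁ hB₂ h₁ h₂ =>
    abs_pairCorr_le_of_singleFlips hω hl hβ hγ hT hN c k hc hM s hB₁ hB₂ h₁ h₂

end Summit.AtomisticToContinuum.FouriersLaw.Theorems.AbelThermodynamicLimit.LoomisCompactHorizonWitness

end
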